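import Mathlib.Geometry.Euclidean.Triangle
import Summits.AtomisticToContinuum.Crystallization.Theorems.OverbindingBudgetAffineFarFieldCollarSites
import Summits.AtomisticToContinuum.Crystallization.Theorems.PalmUnimodularRigidityShellsToBarlowChartQuotientGrowth

/-!
# Overbinding budget, affine far field — «CollarForms»: the atlas predicates in integer form

Support file for `Summit.AtomisticToContinuum.Crystallization.Theses.OverbindingBudget.RobustDefectLimitWindows`
(sub-problem (2c), leaf SW♭(30), part 27V, interface row (R*), soundness side «27VI-SOUND»). With the bookkeeping centre
chosen at a reference site `q₀ = placedSite s ν q R u₀` (a free bookkeeping choice of the window), every geometric predicate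
the atlas must decide is an INTEGER inequality in the distance form `F = barlowSiteForm s` («CollarSites»:
`12·dist² = ν²·F`):

* core membership `dist (site u) q₀ ≤ r_c ↔ ν²·F(u,u₀) ≤ 12·r_c²`;
* ★ the star test of `interfaceRow_le_of_dist`: `48·dist (site u) (midpoint (site a) (site b))² = ν²·(2F(u,a) + 2F(u,b) − F(a,b))`
  (Apollonius), hence `dist ≤ T ↔ ν²·(2F(u,a) + 2F(u,b) − F(a,b)) ≤ 48·T²` for `T ≥ 0`.

So the piece list, the core set and the star supports of the widths are decided by `decide`-able arithmetic over `ℤ³`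
pairs once `(r_c/ν)²` and the width table are rational. [this file; Conway–Sloane, Sphere Packings ch. 4]
-/

namespace Summit.AtomisticToContinuum.Crystallization.Theorems.OverbindingBudgetAffineFarFieldCollarForms

noncomputable section

open Set Metric
open Literature.MathematicalPhysics.StatisticalMechanics (IsHaggSeq haggLabel)
open Summit.AtomisticToContinuum.Crystallization.Theorems.PalmUnimodularRigidityShellsToBarlowChart.QuotientGrowth
  (abs_haggLabel_sub_le)
open Summit.AtomisticToContinuum.Crystallization.Theorems.OverbindingBudgetAffineFarFieldCollarSites

local notation "E3" => EuclideanSpace ℝ (Fin 3)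
local notation "Idx" => ℤ × ℤ × ℤ

variable {s : ℤ → ℤ} {ν : ℝ} {q : E3} {R : E3 ≃ₗᵢ[ℝ] E3}

/-- support: a distance test between placed sites in integer form: `dist ≤ T ↔ ν²·F ≤ 12·T²` (`T ≥ 0`). [«CollarSites»] -/
theorem dist_placedSite_le_iff (hν : 0 ≤ ν) {T : ℝ} (hT : 0 ≤ T) (u u' : Idx) :
    dist (placedSite s ν q R u) (placedSite s ν q R u') ≤ T ↔ ν ^ 2 * (barlowSiteForm s u u' : ℝ) ≤ 12 * T ^ 2 := by
  rw [← twelve_mul_dist_placedSite_sq hν u u', mul_le_mul_iff_of_pos_left (by norm_num : (0 : ℝ) < 12),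
    sq_le_sq₀ dist_nonneg hT]

/-- support: the strict converse test `T < dist ↔ 12·T² < ν²·F` (`T ≥ 0`). [«CollarSites»] -/
theorem lt_dist_placedSite_iff (hν : 0 ≤ ν) {T : ℝ} (hT : 0 ≤ T) (u u' : Idx) :
    T < dist (placedSite s ν q R u) (placedSite s ν q R u') ↔ 12 * T ^ 2 < ν ^ 2 * (barlowSiteForm s u u' : ℝ) := by
  rw [← not_le, dist_placedSite_le_iff hν hT, not_le]

/-- support ★ (Apollonius in integer form): the squared distance from a placed site to the midpoint of two placed sites.
[this file] -/
theorem fortyEight_mul_dist_placedSite_midpoint_sq (hν : 0 ≤ ν) (u a b : Idx) :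
    48 * dist (placedSite s ν q R u) (midpoint ℝ (placedSite s ν q R a) (placedSite s ν q R b)) ^ 2 =
      ν ^ 2 * (2 * (barlowSiteForm s u a : ℝ) + 2 * (barlowSiteForm s u b : ℝ) - (barlowSiteForm s a b : ℝ)) := by
  have hA := EuclideanGeometry.dist_sq_add_dist_sq_eq_two_mul_dist_midpoint_sq_add_half_dist_sq (placedSite s ν q R u)
    (placedSite s ν q R a) (placedSite s ν q R b)
  have h1 := twelve_mul_dist_placedSite_sq (s := s) (q := q) (R := R) hν u a
  have h2 := twelve_mul_dist_placedSite_sq (s := s) (q := q) (R := R) hν u b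
  have h3 := twelve_mul_dist_placedSite_sq (s := s) (q := q) (R := R) hν a b
  linear_combination (-24) * hA + 2 * h1 + 2 * h2 - h3

/-- support ★: the star test of the interface row in integer form: `dist (site u) (midpoint k) ≤ T ↔
ν²·(2F(u,a) + 2F(u,b) − F(a,b)) ≤ 48·T²` (`T ≥ 0`). [this file] -/
theorem dist_placedSite_midpoint_le_iff (hν : 0 ≤ ν) {T : ℝ} (hT : 0 ≤ T) (u a b : Idx) :
    dist (placedSite s ν q R u) (midpoint ℝ (placedSite s ν q R a) (placedSite s ν q R b)) ≤ T ↔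
      ν ^ 2 * (2 * (barlowSiteForm s u a : ℝ) + 2 * (barlowSiteForm s u b : ℝ) - (barlowSiteForm s a b : ℝ)) ≤ 48 * T ^ 2 := by
  rw [← fortyEight_mul_dist_placedSite_midpoint_sq hν u a b, mul_le_mul_iff_of_pos_left (by norm_num : (0 : ℝ) < 48),
    sq_le_sq₀ dist_nonneg hT]

/-- support: scale cancellation for the star test: the atlas books the star radius `T = r₀ + 2w + ρ` through a rational
multiple `ν·t` of the scale, and `ν²·X ≤ 48·(ν t)² ↔ X ≤ 48 t²` (`0 < ν`). [this file] -/
theorem form_le_iff_of_scale (hν : 0 < ν) (X t : ℝ) : ν ^ 2 * X ≤ 48 * (ν * t) ^ 2 ↔ X ≤ 48 * t ^ 2 := by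
  rw [mul_pow, show (48 : ℝ) * (ν ^ 2 * t ^ 2) = ν ^ 2 * (48 * t ^ 2) by ring]
  exact mul_le_mul_iff_of_pos_left (by positivity)

/-- support: core membership about a reference site in integer form, scale-free: `dist (site u) (site u₀) ≤ ν·ρc ↔
F(u,u₀) ≤ 12·ρc²` (`0 < ν`, `0 ≤ ρc`; `ρc = r_c/ν = 12` of record). [this file] -/
theorem dist_placedSite_le_scale_iff (hν : 0 < ν) {ρc : ℝ} (hρ : 0 ≤ ρc) (u u₀ : Idx) :
    dist (placedSite s ν q R u) (placedSite s ν q R u₀) ≤ ν * ρc ↔ (barlowSiteForm s u u₀ : ℝ) ≤ 12 * ρc ^ 2 := by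
  rw [dist_placedSite_le_iff hν.le (by positivity), mul_pow, show (12 : ℝ) * (ν ^ 2 * ρc ^ 2) = ν ^ 2 * (12 * ρc ^ 2) by ring]
  exact mul_le_mul_iff_of_pos_left (by positivity)

/-- support: the same for the strict outer test. [this file] -/
theorem scale_lt_dist_placedSite_iff (hν : 0 < ν) {ρc : ℝ} (hρ : 0 ≤ ρc) (u u₀ : Idx) :
    ν * ρc < dist (placedSite s ν q R u) (placedSite s ν q R u₀) ↔ 12 * ρc ^ 2 < (barlowSiteForm s u u₀ : ℝ) := by
  rw [← not_le, dist_placedSite_le_scale_iff hν hρ, not_le]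

/-! ## The search box: sites of bounded form lie in an explicit coordinate box -/

/-- support ★ (search box): a pair of form `≤ K` has layer offset `8·Δl² ≤ K`, second in-layer coordinate `4·Δb² ≤ K` and
first in-layer coordinate `24·Δa² ≤ 13·K` — so the core (`K = 12ρc²`) and the neighbours of form `≤ 24` of a site are
enumerated by an explicit finite box; the label Lipschitz bound `|Δℓ| ≤ |Δl|` is the TREE lemma
`ShellsToBarlowChart.QuotientGrowth.abs_haggLabel_sub_le`. [this file] -/
theorem coord_sq_le_of_barlowSiteForm_le (hs : IsHaggSeq s) {u u' : Idx} {K : ℤ} (hK : barlowSiteForm s u u' ≤ K) :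
    8 * (u.1 - u'.1) ^ 2 ≤ K ∧ 4 * (u.2.2 - u'.2.2) ^ 2 ≤ K ∧ 24 * (u.2.1 - u'.2.1) ^ 2 ≤ 13 * K := by
  have hℓ : (haggLabel s u.1 - haggLabel s u'.1) ^ 2 ≤ (u.1 - u'.1) ^ 2 := by
    rw [← sq_abs, ← sq_abs (u.1 - u'.1)]
    exact pow_le_pow_left₀ (abs_nonneg _) (abs_haggLabel_sub_le hs u.1 u'.1) 2
  unfold barlowSiteForm at hK
  set Δa := u.2.1 - u'.2.1
  set Δb := u.2.2 - u'.2.2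
  set Δl := u.1 - u'.1
  set Δℓ := haggLabel s u.1 - haggLabel s u'.1
  have h1 : 0 ≤ 3 * (2 * Δa + Δb + Δℓ) ^ 2 := by positivity
  have h2 : 0 ≤ (3 * Δb + Δℓ) ^ 2 := by positivity
  have h3 : 0 ≤ 8 * Δl ^ 2 := by positivity
  have hl : 8 * Δl ^ 2 ≤ K := by linarith
  refine ⟨hl, ?_, ?_⟩
  · nlinarith [sq_nonneg (3 * Δb + 2 * Δℓ), sq_nonneg (3 * Δb + Δℓ)]
  · nlinarith [sq_nonneg (2 * Δa - Δb - Δℓ), sq_nonneg (3 * Δb + 2 * Δℓ), sq_nonneg (Δb - Δℓ), sq_nonneg (Δb + Δℓ),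
      sq_nonneg (2 * Δa + Δb + Δℓ)]

end

end Summit.AtomisticToContinuum.Crystallization.Theorems.OverbindingBudgetAffineFarFieldCollarForms
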